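import Literature.AlgebraicGeometry.Frobenioids.ArchimedeanBasicProperties
import Literature.AlgebraicGeometry.Frobenioids.AngularFrobenioidsRelative
import HarnessLib

/-!
# Frobenioids II, Theorem 3.6 (vi) — PROVED for the archimedean Frobenioid `C` and the angular
# Frobenioid `A` over any base `D → D₀`

Mochizuki, *The geometry of Frobenioids II*, Kyushu J. Math. **62** (2008) 401–460, §3, Theorem 3.6
(vi), author's kurims text p. 37 [cite: MochizukiFrdII2008, Thm 3.6 (vi) p.37]:

> "(vi) If `D` admits a pseudo-terminal object, then `F` admits a pseudo-terminal object."

(proof, p. 39: "Assertions (iv), (v), (vi) follow immediately from the definitions"). Here `F` is the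
archimedean Frobenioid `C = C₀ ×_{D₀} D` (the case `Λ = ℤ` of `C^Λ`) or the angular Frobenioid `A ⊆ C`
of Example 3.3, as constructed in `AngularFrobenioidsRelative.lean` (seat abc-iut-L1-t6), and the
statement is the generic predicate `ArchFrd.Thm36vi` of `ArchimedeanBasicProperties.lean`. DISCHARGE:
given a pseudo-terminal `B ∈ Ob(D)`, the object `(Spec K_B, V, isotropic angular region of tip 1)` over
`B` is pseudo-terminal in `C` and in `A`: an object `X` maps to it by (any arrow `X_D → B`, `deg_Fr = 1`,
the real scalar `1/tip(X)`), and that arrow is an isometry. (`C^Λ` for `Λ ∈ {ℚ, ℝ}` is an interface in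
the tree and is not treated.) No statement of the paper is strengthened.
-/

namespace Literature.AlgebraicGeometry.Frobenioids

open CategoryTheory
open scoped Pointwise

universe v u

namespace ArchFrd

variable {D : Type u} [Category.{v} D] (π : D ⥤ D0)

/-- The object of `C₀` over `K ∈ Ob(D₀)` with isotropic angular region of tip `1`.
[cite: MochizukiFrdII2008, Ex 3.3 (i) p.27] -/
noncomputable def C0.unitObj (K : D0) : C0 :=
  ⟨K, AngularRegion.isotropicOfTip 1, fun _ => AngularRegion.isIsotropic_isotropicOfTip 1⟩

/-- The object of `C = C₀ ×_{D₀} D` over `B ∈ Ob(D)` with isotropic angular region of tip `1`.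
[cite: MochizukiFrdII2008, Ex 3.3 (i) p.28] -/
noncomputable def unitObjOver (B : D) : C π := ⟨C0.unitObj (π.obj B), B, Iso.refl _⟩

/-- The arrow of `C₀` from any object `X` to the tip-`1` isotropic object over a given base arrow:
`deg_Fr = 1`, scalar the positive real `1/tip(X)`. [cite: MochizukiFrdII2008, Thm 3.6 (vi) p.37] -/
noncomputable def C0.toUnitObj (X : C0) {K : D0} (b : X.base ⟶ K) : X ⟶ C0.unitObj K where
  base := b
  degFr := 1
  scalar := N0.rescale X (C0.unitObj K)
  scalar_mem := N0.rescale_mem_scalars _ _ _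
  mapsTo := by
    rw [PNat.one_coe, pow_one]
    rintro _ ⟨u, hu, rfl⟩
    change _ ∈ (D0.Hom.act b) '' (AngularRegion.isotropicOfTip (K := ℂ) 1).carrier
    rw [C0.image_galAct_of_isIsotropic (AngularRegion.isIsotropic_isotropicOfTip _),
      C0.mem_carrier_of_isIsotropic (AngularRegion.isIsotropic_isotropicOfTip _)]
    change absHom ℂ (N0.rescale X (C0.unitObj K) * u) ≤ 1
    have hu' : ((absHom ℂ u : PosReal) : ℝ) ≤ X.tip := hu.2
    rw [coe_absHom] at hu'
    rw [← Subtype.coe_le_coe, map_mul, Positive.val_mul, coe_absHom, coe_absHom, N0.norm_rescale]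
    change (((1 : PosReal) : ℝ) / X.tip) * ‖(u : ℂ)‖ ≤ ((1 : PosReal) : ℝ)
    rw [Positive.val_one, one_div, inv_mul_le_iff₀ X.tip_pos, mul_one]
    exact hu'

/-- That arrow is an isometry: `‖1/tip(X)‖ · tip(X) = 1`. [cite: MochizukiFrdII2008, Thm 3.6 (vi) p.37] -/
theorem C0.isIsometry_toUnitObj (X : C0) {K : D0} (b : X.base ⟶ K) :
    PreFrobenioid.IsIsometry C0.toElem (C0.toUnitObj X b) := by
  rw [A0.isIsometry_iff_norm_mul_tip_pow]
  change ‖(N0.rescale X (C0.unitObj K) : ℂ)‖ * X.tip ^ ((1 : ℕ+) : ℕ) = (C0.unitObj K).tip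
  rw [N0.norm_rescale, PNat.one_coe, pow_one, div_mul_cancel₀ _ X.tip_pos.ne']

/-- The arrow of `C` from `X` to the tip-`1` object over `B`, lying over a given `X_D → B`.
[cite: MochizukiFrdII2008, Thm 3.6 (vi) p.37] -/
noncomputable def toUnitObjOver (X : C π) {B : D} (g : X.snd ⟶ B) : X ⟶ unitObjOver π B where
  fst := C0.toUnitObj X.fst (X.iso.hom ≫ π.map g)
  snd := g
  w := by
    change (X.iso.hom ≫ π.map g) ≫ 𝟙 _ = X.iso.hom ≫ π.map g
    exact Category.comp_id _

/-- **Theorem 3.6 (vi) for `C`** (PROVED): if `D` admits a pseudo-terminal object, so does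
`C = C₀ ×_{D₀} D`. [cite: MochizukiFrdII2008, Thm 3.6 (vi) p.37] -/
theorem thm36vi_C : Thm36vi D (C π) := by
  rintro ⟨B, hB⟩
  exact ⟨unitObjOver π B, fun X => ⟨toUnitObjOver π X (hB X.snd).some⟩⟩

/-- **Theorem 3.6 (vi) for `A`** (PROVED): if `D` admits a pseudo-terminal object, so does the angular
Frobenioid `A ⊆ C` (the comparison arrows are isometries). [cite: MochizukiFrdII2008, Thm 3.6 (vi) p.37] -/
theorem thm36vi_A : Thm36vi D (A π) := by
  rintro ⟨B, hB⟩
  refine ⟨⟨unitObjOver π B⟩, fun X => ⟨⟨toUnitObjOver π X.obj (hB X.obj.snd).some, ?_⟩⟩⟩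
  change PreFrobenioid.IsIsometry (C.toElem π) (toUnitObjOver π X.obj (hB X.obj.snd).some)
  change pull Φ₀ X.obj.iso.inv (PreFrobenioid.Div C0.toElem (C0.toUnitObj X.obj.fst _)) = 1
  rw [C0.isIsometry_toUnitObj]
  exact map_one _

end ArchFrd

end Literature.AlgebraicGeometry.Frobenioids
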